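import Mathlib.MeasureTheory.Integral.DominatedConvergence
import Mathlib.MeasureTheory.Integral.IntervalIntegral.FundThmCalculus
import Mathlib.Analysis.Calculus.ParametricIntegral
import Mathlib.Analysis.SpecialFunctions.ExpDeriv
import Mathlib.MeasureTheory.Measure.HasOuterApproxClosed
import HarnessLib

/-!
# Schwinger–Dyson (derivative) form versus Haar-shift (measure) form of the loop equations: one continuous flow (gauge-boot, L1 supplement)

HONEST FRAMING (cell `pub-gaugeboot`, page 1 of every file): the venture produces certified bounds
on lattice expectations at stated coupling, gauge group, dimension and torus size; NOT a mass gap,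
NOT a continuum limit, NOT a string tension; NOT Yang–Mills-summit-bearing (barriers
`FixedCouplingUltralocality`, `PerturbativeInvisibility`). This module is a structural statement
(abstract measure theory on a compact space); it certifies no number.

## Content

The lattice bootstrap consumes the loop equations in DERIVATIVE form — the one-link
Schwinger–Dyson identity `∫ f' dμ = β ∫ f S' dμ` for observables `f` differentiable along the left
shift `T_t : U ↦ U[e ↦ k(t) U_e]` of a one-parameter subgroup `k` (tree:
`…CurvatureAmnesia.WardDefect.SchwingerDyson.integral_shiftDeriv_eq_wilson`, the cell's
`sd_pair` / `loopEquation_of_sdPair`) — while the cell's state classes (`IsHaarShiftState`, Class B,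
Class T) are axiomatised by the MEASURE form, the finite Haar-shift identity
`∫ F(T_τ U) dμ = ∫ F(U) e^{-β (S(T_{-τ} U) - S(U))} dμ`. This file proves, for ONE jointly continuous
flow `T` (`IsContinuousFlow`: `T_{t+s} = T_t ∘ T_s`, `T_0 = id`) on a compact space, a finite measure
`μ` and a continuous "action" `S` with a continuous derivative `S'` along the flow, that the two
forms are EQUIVALENT (`sd_iff_forall_integral_comp_flow_eq`):

* ★ `integral_comp_flow_eq_integral_mul_exp_of_sd` (derivative ⇒ measure form). No Lie theory and
  no differentiability of the test function `F` is needed: the AVERAGING TRICK feeds the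
  Schwinger–Dyson identity the pair `h = ∫_0^τ K ∘ T_s ds`, `h' = K ∘ T_τ - K` (fundamental theorem
  of calculus along the flow, `hasDerivAt_flowAverage`) multiplied by the weight `e^{β S}`, with
  `K = F · e^{-β S ∘ T_{-τ}}`; the `β`-terms cancel and what is left is the shift identity.
  A predicate `P` on the test function is threaded through, so that the same lemma serves
  restricted test classes (cylinder observables on `ℤ^d`).
* `integral_comp_flow_eq_of_forall_integral_deriv_eq_zero`, `map_flow_eq_of_forall_integral_deriv_eq_zero`
  — the weightless case: a finite measure annihilating every flow derivative `h'` is invariant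
  under the flow ("infinitesimal invariance ⇒ invariance").
* `integral_deriv_mul_eq_zero_of_forall_integral_comp_flow_mul_eq`,
  `sd_of_forall_integral_comp_flow_eq_integral_mul_exp` (measure ⇒ derivative form):
  differentiate the shift identity at `τ = 0` under the integral sign (bounded Lipschitz families,
  as in the tree's proof of the Wilson-measure Schwinger–Dyson identity).

The sequels assemble the flows of all links and all one-parameter subgroups: in finite volume the
Schwinger–Dyson identities characterise the Wilson measure at every `β`
(`SchwingerDysonDeterminesWilson.lean`), on `ℤ^d` they characterise the DLR states.

References: the equivalence "`∫ X(f) dν = 0` for all `f` ⇔ `ν` is invariant under the flow of `X`"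
is standard (Liouville / infinitesimal invariance; V. I. Bogachev, *Differentiable Measures and the
Malliavin Calculus* (AMS 2010) Ch. 3; J. M. Lee, *Introduction to Smooth Manifolds* (2012) Ch. 9);
for lattice gauge theory: S. Chatterjee, arXiv:1502.07719 §3; H. Shen, S. Smith, R. Zhu,
arXiv:2202.00880 §3; H. Shen, R. Zhu, X. Zhu, arXiv:2204.12737 (Schwinger–Dyson equations as the
stationarity of the Langevin dynamics). Folklore; no printed statement of the averaging-trick form
was found.
-/

noncomputable section

open MeasureTheory Filter Topology

namespace Summit.QuantumFields.GaugeBoot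

variable {Ω : Type*} [TopologicalSpace Ω]

/-- A CONTINUOUS FLOW on `Ω`: a jointly continuous one-parameter family of self-maps with the flow
law `T_{t+s} = T_t ∘ T_s` and `T_0 = id`. The one-link left shifts `U ↦ U[e ↦ k(t) U_e]` of a
continuous one-parameter subgroup `k` of the gauge group are the examples used in the sequels.
[shape] A hypothesis structure (a `Prop`), asserting nothing. [folklore] -/
structure IsContinuousFlow (T : ℝ → Ω → Ω) : Prop where
  /-- the flow law `T (t + s) x = T t (T s x)` (shape of the tree's `SchwingerDyson.shift_flow`) -/
  flow : ∀ s t x, T (t + s) x = T t (T s x)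
  /-- `T 0 = id` -/
  map_zero : ∀ x, T 0 x = x
  /-- joint continuity in time and space -/
  continuous : Continuous fun p : ℝ × Ω => T p.1 p.2

namespace IsContinuousFlow

variable {T : ℝ → Ω → Ω}

/-- Orbits of a continuous flow are continuous in time. [folklore] -/
theorem continuous_left (hT : IsContinuousFlow T) (x : Ω) : Continuous fun s : ℝ => T s x :=
  hT.continuous.comp (continuous_id.prodMk continuous_const)

/-- Each time-`t` map of a continuous flow is continuous. [folklore] -/
theorem continuous_right (hT : IsContinuousFlow T) (t : ℝ) : Continuous (T t) :=
  hT.continuous.comp (continuous_const.prodMk continuous_id)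

/-- `T_{-t} ∘ T_t = id`. [folklore] -/
theorem neg_comp (hT : IsContinuousFlow T) (t : ℝ) (x : Ω) : T (-t) (T t x) = x := by
  rw [← hT.flow, neg_add_cancel, hT.map_zero]

/-- `T_t ∘ T_{-t} = id`. [folklore] -/
theorem comp_neg (hT : IsContinuousFlow T) (t : ℝ) (x : Ω) : T t (T (-t) x) = x := by
  rw [← hT.flow, add_neg_cancel, hT.map_zero]

/-! ## Flow averages and the fundamental theorem of calculus along the flow -/

/-- Shifting the starting point shifts the averaging window:
`∫_0^τ F(T_s(T_t x)) ds = ∫_t^{t+τ} F(T_s x) ds`. [folklore] -/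
theorem intervalIntegral_comp_flow (hT : IsContinuousFlow T) (F : Ω → ℝ) (τ t : ℝ) (x : Ω) :
    ∫ s in (0:ℝ)..τ, F (T s (T t x)) = ∫ s in t..t + τ, F (T s x) := by
  have h : ∀ s, F (T s (T t x)) = F (T (s + t) x) := fun s => by rw [hT.flow]
  simp_rw [h]
  rw [show (∫ s in (0:ℝ)..τ, F (T (s + t) x)) = ∫ s in (0:ℝ) + t..τ + t, F (T s x) from
      intervalIntegral.integral_comp_add_right (f := fun s => F (T s x)) t, zero_add, add_comm]

/-- **Fundamental theorem of calculus along the flow**: the flow average `h = ∫_0^τ F ∘ T_s ds`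
of an observable with continuous orbits is differentiable along the flow at time `0`, with
derivative `F ∘ T_τ - F`. [folklore] -/
theorem hasDerivAt_flowAverage (hT : IsContinuousFlow T) {F : Ω → ℝ} {x : Ω}
    (hF : Continuous fun s : ℝ => F (T s x)) (τ : ℝ) :
    HasDerivAt (fun t => ∫ s in (0:ℝ)..τ, F (T s (T t x))) (F (T τ x) - F x) 0 := by
  have hprim : ∀ u : ℝ, HasDerivAt (fun u => ∫ s in (0:ℝ)..u, F (T s x)) (F (T u x)) u := fun u =>
    intervalIntegral.integral_hasDerivAt_right (hF.intervalIntegrable _ _)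
      (hF.stronglyMeasurableAtFilter _ _) hF.continuousAt
  have h1 : (fun t => ∫ s in (0:ℝ)..τ, F (T s (T t x))) =
      fun t => (∫ s in (0:ℝ)..t + τ, F (T s x)) - ∫ s in (0:ℝ)..t, F (T s x) := by
    funext t
    rw [intervalIntegral_comp_flow hT F τ t x,
      intervalIntegral.integral_interval_sub_left (hF.intervalIntegrable _ _)
        (hF.intervalIntegrable _ _)]
  rw [h1]
  have h2 : HasDerivAt (fun t => ∫ s in (0:ℝ)..t + τ, F (T s x)) (F (T τ x)) 0 := by
    have h := HasDerivAt.comp_add_const (0:ℝ) τ (hprim (0 + τ))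
    rwa [zero_add] at h
  have h3 := h2.sub (hprim 0)
  rwa [hT.map_zero] at h3

/-- The flow average of a continuous observable is continuous (joint continuity of the flow).
[folklore] -/
theorem continuous_flowAverage (hT : IsContinuousFlow T) {F : Ω → ℝ} (hF : Continuous F) (τ : ℝ) :
    Continuous fun x => ∫ s in (0:ℝ)..τ, F (T s x) :=
  intervalIntegral.continuous_parametric_intervalIntegral_of_continuous'
    (f := fun (x : Ω) (s : ℝ) => F (T s x)) (hF.comp (hT.continuous.comp continuous_swap)) 0 τ

/-! ## Infinitesimal invariance implies invariance -/

variable [MeasurableSpace Ω] [OpensMeasurableSpace Ω] [CompactSpace Ω]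

omit [OpensMeasurableSpace Ω] in
/-- Continuous functions on a compact space are integrable for a finite measure. [folklore] -/
theorem integrable_of_continuous_of_compactSpace [OpensMeasurableSpace Ω] (ν : Measure Ω)
    [IsFiniteMeasure ν] {f : Ω → ℝ} (hf : Continuous f) : Integrable f ν := by
  obtain ⟨C, hC⟩ := isCompact_univ.exists_bound_of_continuousOn hf.continuousOn
  exact Integrable.of_bound hf.aestronglyMeasurable C (ae_of_all _ fun x => hC x (Set.mem_univ x))

/-- **Infinitesimal invariance ⇒ invariance** (observable form): if a finite measure `ν` on a
compact space annihilates the flow derivative `h'` of every continuous observable `h` (in a class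
`P` containing the flow averages of `F`) differentiable along the flow with continuous derivative,
then `∫ F ∘ T_τ dν = ∫ F dν`. Proof: the pair `h = ∫_0^τ F ∘ T_s ds`, `h' = F ∘ T_τ - F`.
[folklore] -/
theorem integral_comp_flow_eq_of_forall_integral_deriv_eq_zero (hT : IsContinuousFlow T)
    (ν : Measure Ω) [IsFiniteMeasure ν] {P : (Ω → ℝ) → Prop}
    (hν : ∀ h h' : Ω → ℝ, P h → Continuous h → Continuous h' →
      (∀ x, HasDerivAt (fun t => h (T t x)) (h' x) 0) → ∫ x, h' x ∂ν = 0)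
    {F : Ω → ℝ} (hF : Continuous F) (τ : ℝ) (hP : P fun x => ∫ s in (0:ℝ)..τ, F (T s x)) :
    ∫ x, F (T τ x) ∂ν = ∫ x, F x ∂ν := by
  have h := hν _ (fun x => F (T τ x) - F x) hP (continuous_flowAverage hT hF τ)
    ((hF.comp (hT.continuous_right τ)).sub hF)
    fun x => hasDerivAt_flowAverage hT (hF.comp (hT.continuous_left x)) τ
  rw [integral_sub (integrable_of_continuous_of_compactSpace ν (f := fun x => F (T τ x))
    (hF.comp (hT.continuous_right τ))) (integrable_of_continuous_of_compactSpace ν hF)] at h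
  exact sub_eq_zero.1 h

omit [OpensMeasurableSpace Ω] in
/-- **Infinitesimal invariance ⇒ invariance** (measure form, Borel `σ`-algebra on a compact space
in which closed sets have outer continuous approximations, e.g. any compact metrisable space):
`ν ∘ T_τ⁻¹ = ν` for every `τ`. [folklore] -/
theorem map_flow_eq_of_forall_integral_deriv_eq_zero [BorelSpace Ω] [HasOuterApproxClosed Ω]
    (hT : IsContinuousFlow T) (ν : Measure Ω) [IsFiniteMeasure ν]
    (hν : ∀ h h' : Ω → ℝ, Continuous h → Continuous h' →
      (∀ x, HasDerivAt (fun t => h (T t x)) (h' x) 0) → ∫ x, h' x ∂ν = 0)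
    (τ : ℝ) : ν.map (T τ) = ν := by
  have hm : Measurable (T τ) := (hT.continuous_right τ).measurable
  haveI : IsFiniteMeasure (ν.map (T τ)) := Measure.isFiniteMeasure_map ν (T τ)
  refine ext_of_forall_integral_eq_of_IsFiniteMeasure fun f => ?_
  rw [integral_map hm.aemeasurable f.continuous.aestronglyMeasurable]
  exact integral_comp_flow_eq_of_forall_integral_deriv_eq_zero hT ν (P := fun _ => True)
    (fun h h' _ hh hh' hd => hν h h' hh hh' hd) f.continuous τ trivial

/-! ## The Schwinger–Dyson identity implies the Haar-shift identity -/

/-- ★ **Derivative form ⇒ measure form of the loop equation along one flow.** Let `μ` be a finite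
measure on a compact space, `S` a continuous "action" with a continuous derivative `S'` along the
continuous flow `T`, and suppose the SCHWINGER–DYSON IDENTITY `∫ f' dμ = β ∫ f S' dμ` holds for
every continuous `f` (in a class `P`) with a continuous derivative `f'` along the flow. Then for
every continuous `F` and every `τ`,
`∫ F(T_τ x) dμ = ∫ F(x) e^{-β (S(T_{-τ} x) - S(x))} dμ` — the finite HAAR-SHIFT IDENTITY.
Proof (averaging trick, no Lie theory): with `K = F · e^{-β S ∘ T_{-τ}}`, feed the pair
`f = (∫_0^τ K ∘ T_s ds) · e^{β S}`, `f' = (K ∘ T_τ - K) e^{β S} + f · β S'`; the `β`-terms cancel.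
The class `P` has to contain this one `f` (hypothesis `hP`). [folklore] -/
theorem integral_comp_flow_eq_integral_mul_exp_of_sd (hT : IsContinuousFlow T) (μ : Measure Ω)
    [IsFiniteMeasure μ] {S S' : Ω → ℝ} (hS : Continuous S) (hS'c : Continuous S')
    (hS' : ∀ x, HasDerivAt (fun t => S (T t x)) (S' x) 0) (β : ℝ) {P : (Ω → ℝ) → Prop}
    (hsd : ∀ f f' : Ω → ℝ, P f → Continuous f → Continuous f' →
      (∀ x, HasDerivAt (fun t => f (T t x)) (f' x) 0) → ∫ x, f' x ∂μ = β * ∫ x, f x * S' x ∂μ)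
    {F : Ω → ℝ} (hF : Continuous F) (τ : ℝ)
    (hP : P fun x => (∫ s in (0:ℝ)..τ, F (T s x) * Real.exp (-(β * S (T (-τ) (T s x))))) *
      Real.exp (β * S x)) :
    ∫ x, F (T τ x) ∂μ = ∫ x, F x * Real.exp (-(β * (S (T (-τ) x) - S x))) ∂μ := by
  -- the test function `K = F · e^{-β S ∘ T_{-τ}}`, its flow average `h`, the weight `w = e^{β S}`
  set K : Ω → ℝ := fun x => F x * Real.exp (-(β * S (T (-τ) x))) with hK
  have hKc : Continuous K :=
    hF.mul (Real.continuous_exp.comp (continuous_const.mul (hS.comp (hT.continuous_right _))).neg)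
  set h : Ω → ℝ := fun x => ∫ s in (0:ℝ)..τ, K (T s x) with hh
  set w : Ω → ℝ := fun x => Real.exp (β * S x) with hw
  have hhc : Continuous h := continuous_flowAverage hT hKc τ
  have hwc : Continuous w := Real.continuous_exp.comp (continuous_const.mul hS)
  have hwd : ∀ x, HasDerivAt (fun t => w (T t x)) (w x * (β * S' x)) 0 := fun x => by
    have h1 := ((hS' x).const_mul β).exp
    simp only [hT.map_zero] at h1
    exact h1
  -- the pair fed to the Schwinger–Dyson identity
  have hd : ∀ x, HasDerivAt (fun t => h (T t x) * w (T t x))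
      ((K (T τ x) - K x) * w x + h x * (w x * (β * S' x))) 0 := fun x => by
    have h1 : HasDerivAt (fun t => h (T t x)) (K (T τ x) - K x) 0 :=
      hasDerivAt_flowAverage hT (hKc.comp (hT.continuous_left x)) τ
    have h2 := h1.mul (hwd x)
    simp only [hT.map_zero] at h2
    exact h2
  have hf'c : Continuous fun x => (K (T τ x) - K x) * w x + h x * (w x * (β * S' x)) :=
    (((hKc.comp (hT.continuous_right τ)).sub hKc).mul hwc).add
      (hhc.mul (hwc.mul (continuous_const.mul hS'c)))
  have key := hsd (fun x => h x * w x)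
    (fun x => (K (T τ x) - K x) * w x + h x * (w x * (β * S' x))) hP (hhc.mul hwc) hf'c hd
  -- bookkeeping: the `β`-terms cancel
  have hi1 : Integrable (fun x => (K (T τ x) - K x) * w x) μ :=
    integrable_of_continuous_of_compactSpace μ (((hKc.comp (hT.continuous_right τ)).sub hKc).mul hwc)
  have hi2 : Integrable (fun x => h x * (w x * (β * S' x))) μ :=
    integrable_of_continuous_of_compactSpace μ (hhc.mul (hwc.mul (continuous_const.mul hS'c)))
  have h2 : ∫ x, h x * (w x * (β * S' x)) ∂μ = β * ∫ x, h x * w x * S' x ∂μ := by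
    rw [← integral_const_mul]
    exact integral_congr_ae (ae_of_all _ fun x => by ring)
  rw [integral_add hi1 hi2, h2, add_eq_right] at key
  -- and what is left is the shift identity
  have hpt : ∀ x, (K (T τ x) - K x) * w x =
      F (T τ x) - F x * Real.exp (-(β * (S (T (-τ) x) - S x))) := fun x => by
    have e1 : Real.exp (-(β * S x)) * Real.exp (β * S x) = 1 := by
      rw [← Real.exp_add, neg_add_cancel, Real.exp_zero]
    have e2 : Real.exp (-(β * S (T (-τ) x))) * Real.exp (β * S x) =
        Real.exp (-(β * (S (T (-τ) x) - S x))) := by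
      rw [← Real.exp_add]
      congr 1
      ring
    simp only [hK, hw, hT.neg_comp, sub_mul, mul_assoc, e1, e2, mul_one]
  have h3 : ∫ x, (K (T τ x) - K x) * w x ∂μ =
      ∫ x, F (T τ x) ∂μ - ∫ x, F x * Real.exp (-(β * (S (T (-τ) x) - S x))) ∂μ := by
    rw [← integral_sub (integrable_of_continuous_of_compactSpace μ (f := fun x => F (T τ x))
      (hF.comp (hT.continuous_right τ))) (integrable_of_continuous_of_compactSpace μ
      (f := fun x => F x * Real.exp (-(β * (S (T (-τ) x) - S x))))
      (hF.mul (Real.continuous_exp.comp (continuous_const.mul ((hS.comp (hT.continuous_right _)).sub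
        hS)).neg)))]
    exact integral_congr_ae (ae_of_all _ hpt)
  rw [h3] at key
  exact sub_eq_zero.1 key

/-! ## The Haar-shift identity implies the Schwinger–Dyson identity -/

/-- **Invariance ⇒ infinitesimal invariance** (weighted): if `∫ h(T_t x) w(x) dν = ∫ h w dν` for
all `t`, for continuous `h`, `w` with `h` differentiable along the flow with continuous derivative
`h'`, then `∫ h' w dν = 0` — differentiate at `t = 0` under the integral sign (the family is
bounded and Lipschitz in `t` on the compact space). [folklore] -/
theorem integral_deriv_mul_eq_zero_of_forall_integral_comp_flow_mul_eq (hT : IsContinuousFlow T)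
    (ν : Measure Ω) [IsFiniteMeasure ν] {w h h' : Ω → ℝ} (hw : Continuous w) (hh : Continuous h)
    (hh' : Continuous h') (hd : ∀ x, HasDerivAt (fun t => h (T t x)) (h' x) 0)
    (hinv : ∀ t, ∫ x, h (T t x) * w x ∂ν = ∫ x, h x * w x ∂ν) : ∫ x, h' x * w x ∂ν = 0 := by
  obtain ⟨Ch, hCh⟩ := isCompact_univ.exists_bound_of_continuousOn hh.continuousOn
  obtain ⟨Ch', hCh'⟩ := isCompact_univ.exists_bound_of_continuousOn hh'.continuousOn
  obtain ⟨Cw, hCw⟩ := isCompact_univ.exists_bound_of_continuousOn hw.continuousOn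
  simp only [Set.mem_univ, forall_const, Real.norm_eq_abs] at hCh hCh' hCw
  -- derivative along the flow at every time, hence a Lipschitz bound
  have hdt : ∀ (x : Ω) (s : ℝ), HasDerivAt (fun t => h (T t x)) (h' (T s x)) s := fun x s => by
    have h2 : (fun t => h (T t x)) = fun t => h (T (t - s) (T s x)) := by
      funext t; rw [← hT.flow, sub_add_cancel]
    rw [h2]
    have h3 : HasDerivAt (fun t => h (T t (T s x))) (h' (T s x)) (s - s) := by
      rw [sub_self]; exact hd (T s x)
    exact h3.comp_sub_const s s
  have hlipx : ∀ (x : Ω) (t s : ℝ), |h (T t x) - h (T s x)| ≤ Ch' * |t - s| := fun x t s => by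
    have h1 := Convex.norm_image_sub_le_of_norm_hasDerivWithin_le (f := fun t => h (T t x))
      (f' := fun t => h' (T t x)) (s := Set.univ) (x := s) (y := t)
      (fun u _ => (hdt x u).hasDerivWithinAt) (fun u _ => by rw [Real.norm_eq_abs]; exact hCh' _)
      convex_univ (Set.mem_univ _) (Set.mem_univ _)
    simpa only [Real.norm_eq_abs] using h1
  set K : ℝ := max (Ch * Cw) (Ch' * Cw) with hKdef
  have hlip : ∀ᵐ x ∂ν, LipschitzOnWith (Real.nnabs ((fun _ : Ω => K) x))
      (fun t => h (T t x) * w x) Set.univ := by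
    refine ae_of_all _ fun x => LipschitzOnWith.of_dist_le_mul fun t _ s _ => ?_
    rw [Real.dist_eq, Real.dist_eq, Real.coe_nnabs, ← sub_mul, abs_mul]
    calc |h (T t x) - h (T s x)| * |w x| ≤ Ch' * |t - s| * Cw :=
          mul_le_mul (hlipx x t s) (hCw x) (abs_nonneg _)
            (mul_nonneg ((abs_nonneg _).trans (hCh' x)) (abs_nonneg _))
      _ = Ch' * Cw * |t - s| := by ring
      _ ≤ |K| * |t - s| := by
          gcongr
          exact (le_max_right _ _).trans (le_abs_self K)
  have hderiv : HasDerivAt (fun t => ∫ x, h (T t x) * w x ∂ν) (∫ x, h' x * w x ∂ν) 0 := by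
    refine (hasDerivAt_integral_of_dominated_loc_of_lip (μ := ν) (F := fun t x => h (T t x) * w x)
      (x₀ := (0 : ℝ)) (s := Set.univ) (bound := fun _ => K) (F' := fun x => h' x * w x)
      Filter.univ_mem (Filter.Eventually.of_forall fun t =>
        ((hh.comp (hT.continuous_right t)).mul hw).aestronglyMeasurable)
      (integrable_of_continuous_of_compactSpace ν ((hh.comp (hT.continuous_right 0)).mul hw))
      (hh'.mul hw).aestronglyMeasurable hlip (integrable_const K) (ae_of_all _ fun x => ?_)).2
    exact (hd x).mul_const (w x)
  have hconst : (fun t => ∫ x, h (T t x) * w x ∂ν) = fun _ => ∫ x, h x * w x ∂ν := funext hinv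
  rw [hconst] at hderiv
  exact ((hasDerivAt_const (0 : ℝ) _).unique hderiv).symm

/-- **Measure form ⇒ derivative form of the loop equation along one flow**: if the finite measure
`μ` satisfies the Haar-shift identity `∫ F(T_τ x) dμ = ∫ F(x) e^{-β (S(T_{-τ} x) - S(x))} dμ` for
every continuous `F` and every `τ`, then it satisfies the Schwinger–Dyson identity
`∫ f' dμ = β ∫ f S' dμ` for every continuous `f` with a continuous derivative `f'` along the flow.
Proof: the weighted measure `e^{β S} dμ` is flow invariant; differentiate at `τ = 0` for the
observable `f e^{-β S}`. [folklore] -/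
theorem sd_of_forall_integral_comp_flow_eq_integral_mul_exp (hT : IsContinuousFlow T)
    (μ : Measure Ω) [IsFiniteMeasure μ] {S S' : Ω → ℝ} (hS : Continuous S) (hS'c : Continuous S')
    (hS' : ∀ x, HasDerivAt (fun t => S (T t x)) (S' x) 0) (β : ℝ)
    (hhs : ∀ F : Ω → ℝ, Continuous F → ∀ τ : ℝ,
      ∫ x, F (T τ x) ∂μ = ∫ x, F x * Real.exp (-(β * (S (T (-τ) x) - S x))) ∂μ)
    {f f' : Ω → ℝ} (hf : Continuous f) (hf'c : Continuous f')
    (hd : ∀ x, HasDerivAt (fun t => f (T t x)) (f' x) 0) :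
    ∫ x, f' x ∂μ = β * ∫ x, f x * S' x ∂μ := by
  set w : Ω → ℝ := fun x => Real.exp (β * S x) with hw
  have hwc : Continuous w := Real.continuous_exp.comp (continuous_const.mul hS)
  -- Step 1: `e^{β S} dμ` is flow invariant on continuous observables
  have hinv : ∀ K : Ω → ℝ, Continuous K → ∀ t : ℝ,
      ∫ x, K (T t x) * w x ∂μ = ∫ x, K x * w x ∂μ := by
    intro K hK t
    have h1 := hhs (fun x => K x * Real.exp (β * S (T (-t) x)))
      (hK.mul (Real.continuous_exp.comp (continuous_const.mul (hS.comp (hT.continuous_right _))))) t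
    have hl : ∀ x, K (T t x) * Real.exp (β * S (T (-t) (T t x))) = K (T t x) * w x := fun x => by
      rw [hT.neg_comp]
    have hr : ∀ x, K x * Real.exp (β * S (T (-t) x)) * Real.exp (-(β * (S (T (-t) x) - S x))) =
        K x * w x := fun x => by
      rw [mul_assoc, ← Real.exp_add]
      congr 2
      ring
    simpa only [hl, hr] using h1
  -- Step 2: differentiate at `0` for the observable `f e^{-β S}`
  have hvc : Continuous fun x => Real.exp (-(β * S x)) :=
    Real.continuous_exp.comp (continuous_const.mul hS).neg
  have hhd : ∀ x, HasDerivAt (fun t => f (T t x) * Real.exp (-(β * S (T t x))))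
      (f' x * Real.exp (-(β * S x)) + f x * (Real.exp (-(β * S x)) * -(β * S' x))) 0 := fun x => by
    have hn : HasDerivAt (fun t => -(β * S (T t x))) (-(β * S' x)) 0 := ((hS' x).const_mul β).neg
    have h1 : HasDerivAt (fun t => f (T t x) * Real.exp (-(β * S (T t x))))
        (f' x * Real.exp (-(β * S (T 0 x))) + f (T 0 x) * (Real.exp (-(β * S (T 0 x))) * -(β * S' x)))
        0 := (hd x).mul hn.exp
    simp only [hT.map_zero] at h1
    exact h1
  have h0 := integral_deriv_mul_eq_zero_of_forall_integral_comp_flow_mul_eq hT μ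
    (h := fun x => f x * Real.exp (-(β * S x)))
    (h' := fun x => f' x * Real.exp (-(β * S x)) + f x * (Real.exp (-(β * S x)) * -(β * S' x)))
    hwc (hf.mul hvc) ((hf'c.mul hvc).add (hf.mul (hvc.mul (continuous_const.mul hS'c).neg))) hhd
    (fun t => hinv (fun x => f x * Real.exp (-(β * S x))) (hf.mul hvc) t)
  have hpt : ∀ x, (f' x * Real.exp (-(β * S x)) + f x * (Real.exp (-(β * S x)) * -(β * S' x))) * w x
      = f' x - β * (f x * S' x) := fun x => by
    have e1 : Real.exp (-(β * S x)) * Real.exp (β * S x) = 1 := by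
      rw [← Real.exp_add, neg_add_cancel, Real.exp_zero]
    calc (f' x * Real.exp (-(β * S x)) + f x * (Real.exp (-(β * S x)) * -(β * S' x))) * w x
        = (f' x - β * (f x * S' x)) * (Real.exp (-(β * S x)) * Real.exp (β * S x)) := by
          simp only [hw]; ring
      _ = f' x - β * (f x * S' x) := by rw [e1, mul_one]
  rw [integral_congr_ae (ae_of_all _ hpt), integral_sub (integrable_of_continuous_of_compactSpace μ hf'c)
    ((integrable_of_continuous_of_compactSpace μ (f := fun x => f x * S' x) (hf.mul hS'c)).const_mul β),
    integral_const_mul] at h0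
  exact sub_eq_zero.1 h0

/-- ★ **The derivative (Schwinger–Dyson) and the measure (Haar-shift) forms of the loop equation
along one continuous flow are EQUIVALENT**, for a finite measure on a compact space and a
continuous action `S` with continuous flow derivative `S'`: `∫ f' dμ = β ∫ f S' dμ` for every
continuous `f` with continuous flow derivative `f'` iff
`∫ F ∘ T_τ dμ = ∫ F e^{-β (S ∘ T_{-τ} - S)} dμ` for every continuous `F` and every `τ`. [folklore] -/
theorem sd_iff_forall_integral_comp_flow_eq (hT : IsContinuousFlow T) (μ : Measure Ω)
    [IsFiniteMeasure μ] {S S' : Ω → ℝ} (hS : Continuous S) (hS'c : Continuous S')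
    (hS' : ∀ x, HasDerivAt (fun t => S (T t x)) (S' x) 0) (β : ℝ) :
    (∀ f f' : Ω → ℝ, Continuous f → Continuous f' →
        (∀ x, HasDerivAt (fun t => f (T t x)) (f' x) 0) → ∫ x, f' x ∂μ = β * ∫ x, f x * S' x ∂μ) ↔
      ∀ F : Ω → ℝ, Continuous F → ∀ τ : ℝ,
        ∫ x, F (T τ x) ∂μ = ∫ x, F x * Real.exp (-(β * (S (T (-τ) x) - S x))) ∂μ :=
  ⟨fun hsd _ hF τ => integral_comp_flow_eq_integral_mul_exp_of_sd hT μ hS hS'c hS' β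
      (P := fun _ => True) (fun f f' _ hf hf' hd => hsd f f' hf hf' hd) hF τ trivial,
    fun hhs _ _ hf hf' hd => sd_of_forall_integral_comp_flow_eq_integral_mul_exp hT μ hS hS'c hS' β
      hhs hf hf' hd⟩

end IsContinuousFlow

end Summit.QuantumFields.GaugeBoot

end
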